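import Literature.NumberTheory.PAdicHodge.EisensteinRootDatum
import Mathlib.Analysis.Normed.Group.Ultra
import HarnessLib

/-!
# Norms in `ℂ_F` of `ℚ_p`-combinations of powers of an Eisenstein root `ϖ`: `‖Σ_{i<e} qᵢ ϖⁱ‖ = max ‖qᵢ‖‖ϖ‖ⁱ`, so each coordinate is
# controlled by the sum — `‖qᵢ‖ ≤ ‖Σ qⱼϖʲ‖ / ‖p‖` (totally ramified: the values `‖qᵢ‖‖ϖ‖ⁱ`, `qᵢ ≠ 0`, are pairwise distinct)

Topic `Literature/NumberTheory/PAdicHodge` (theorems only; no definition, no named fact, no instance, no `sorry`). Setting: `F` a `p`-adic field,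
`hp : valuation F p < 1`, `K₀ = PadicBase F p hp` (the canonical `ℚ_p ⊆ F` with the restricted norm; `‖x‖ = ‖p‖^{v_p(x)}`,
`PadicBase.norm_eq_norm_p_zpow`), `D` an Eisenstein root datum of degree `e` (`𝒪_D = ℤ_p[ϖ]`, `‖ϖ‖ᵉ = ‖p‖` in `ℂ_F`, `EisensteinRoot.norm_rootC_pow`),
and `ι : K₀ → F → ℂ_F`.

* §1 `norm_iota` (`‖ι x‖ = ‖x‖`), `norm_iota_mul_root_pow_pow_e` (`(‖ι x‖·‖ϖ‖ⁱ)ᵉ = ‖p‖^{e·v_p(x) + i}`), ★ `norm_term_ne_of_ne`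
  — for `x, y ≠ 0` and `i ≠ j < e` the norms `‖ι x·ϖⁱ‖`, `‖ι y·ϖʲ‖` are DIFFERENT (`e·v + i ≡ i (mod e)` pins `i`);
* §2 ★★ `norm_iota_mul_root_pow_le_norm_sum` — **`‖ι(qᵢ)‖·‖ϖ‖ⁱ ≤ ‖Σ_{j<e} ι(qⱼ)·ϖʲ‖`** for every `i` (ultrametric equality on the support,
  Mathlib `IsUltrametricDist.nnnorm_sum_eq_sup_of_pairwise_ne`), hence ★ `norm_le_norm_sum_div_norm_p` — **`‖qᵢ‖ ≤ ‖Σ_j ι(qⱼ)ϖʲ‖/‖p‖`**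
  (`‖ϖ‖ⁱ ≥ ‖ϖ‖ᵉ = ‖p‖`): the coordinates in the power basis `1, ϖ, …, ϖ^{e−1}` are controlled by the element — the analytic form of
  «`ℤ_p[ϖ]` is the valuation ring of `ℚ_p(ϖ)`» (Serre, Local Fields I §6 Prop. 18) that the CM-fibre transport road needs;
* §3 `norm_coeff_coord_le_of_norm_coeff_sum_le` — the same coefficientwise for multivariable series `G = Σ_i ϖⁱ·ι_*(Gᵢ)`;
  `norm_pow_mul_toPadic_le_one_of_norm_le` — transfer of a bound `‖x‖_{K₀} ≤ ‖p‖^{−d}` to `|p^d x|_p ≤ 1` (the `ℚ_p`-form used by the tree's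
  `KatzRankAllFibres.padicRankTwo`); `exists_le_norm_p_zpow_neg` (every real bound is `≤ ‖p‖^{−d}` for some `d`).

Purpose (line `kato_lever`, crux K★ `stmt-BirchSwinnertonDyer-22226`, memo `Lines/kato-lever-K2-ramified-cm-transport.md` §8 step 1): the coordinates of
`log_{W_D} ∈ L⟦X⟧` (`L = ℚ_p(ϖ)`) in the power basis are `ℚ_p`-series whose `F_{E₀}`-coboundaries are bounded BECAUSE the `L`-coboundary is
(`FormalLogSecondKindCongruentLaws` p767466 + this file), so `padicRankTwo (E₀ ⊗ ℤ_p)` applies to each coordinate and yields the Hodge line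
`log_{W_D} ≡ A·log_{E₀} + B·log_{E₀}(Xᵖ)`. BSD / K★ are not proved by any of this; nothing about elliptic curves over number fields is proved here.

## References
* J.-P. Serre, *Local Fields* (1979), Ch. I §6 Prop. 17–18 (totally ramified extensions: `𝒪_L = ℤ_p[ϖ]`, `v(Σ aᵢϖⁱ) = min(e·v(aᵢ) + i)`). [SerreLocalFields1979]
* J. Neukirch, *Algebraic Number Theory* (1999), Ch. II (4.8), (6.2). [NeukirchANT1999]
-/

noncomputable section

open scoped Classical NNReal
open ValuativeRel Field

namespace Literature.NumberTheory.PAdicHodge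

open Literature.NumberTheory.GaloisRepresentations Literature.NumberTheory.GaloisRepresentations.IsNonarchimedeanLocalField

variable {F : Type} [Field F] [ValuativeRel F] [TopologicalSpace F] [IsNonarchimedeanLocalField F] [CharZero F]
  {p : ℕ} [hpp : Fact p.Prime] {hp : valuation F p < 1} (D : EisensteinRoot F p hp)

/-! ## §1 Norms of the individual terms `ι(x)·ϖⁱ` -/

/-- `‖ι x‖_{ℂ_F} = ‖x‖_{K₀}` for `ι : K₀ → F → ℂ_F`. [cite: NeukirchANT1999, Ch. II (4.8)] -/
theorem norm_iota (hp : valuation F p < 1) (x : PadicBase F p hp) :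
    ‖algebraMap F (CompletedAlgClosure F) (algebraMap (PadicBase F p hp) F x)‖ = ‖x‖ := by
  rw [CompletedAlgClosure.norm_algebraMap]; exact PadicBase.norm_algebraMap hp x

/-- `‖p‖_{ℂ_F} = ‖p‖_{K₀}`. [cite: NeukirchANT1999, Ch. II (4.8)] -/
theorem norm_natCast_C_eq_norm_natCast_padicBase (hp : valuation F p < 1) :
    ‖(p : CompletedAlgClosure F)‖ = ‖(p : PadicBase F p hp)‖ := by
  have h : (p : CompletedAlgClosure F) = algebraMap F (CompletedAlgClosure F) (algebraMap (PadicBase F p hp) F (p : PadicBase F p hp)) := by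
    rw [map_natCast, map_natCast]
  rw [h, norm_iota]

/-- **`(‖ι x‖·‖ϖ‖ⁱ)ᵉ = ‖p‖^{e·v_p(x) + i}`** for `x ≠ 0` (`‖x‖ = ‖p‖^{v_p(x)}`, `‖ϖ‖ᵉ = ‖p‖`). [cite: SerreLocalFields1979, Ch. I §6 Prop. 17] -/
theorem norm_iota_mul_root_pow_pow_e (x : PadicBase F p hp) (hx : x ≠ 0) (i : ℕ) :
    (‖algebraMap F (CompletedAlgClosure F) (algebraMap (PadicBase F p hp) F x) *
        ((D.rootC : integerC F) : CompletedAlgClosure F) ^ i‖) ^ D.e =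
      ‖(p : CompletedAlgClosure F)‖ ^ ((D.e : ℤ) * (PadicBase.toPadic hp x).valuation + i) := by
  have hp0 : ‖(p : CompletedAlgClosure F)‖ ≠ 0 := by
    rw [norm_natCast_C_eq_norm_natCast_padicBase hp]; exact (PadicBase.norm_p_pos hp).ne'
  rw [norm_mul, norm_pow, norm_iota, PadicBase.norm_eq_norm_p_zpow hp x hx, ← norm_natCast_C_eq_norm_natCast_padicBase hp, mul_pow,
    ← pow_mul, mul_comm i D.e, pow_mul, EisensteinRoot.norm_rootC_pow, ← zpow_natCast (‖(p : CompletedAlgClosure F)‖ ^ _) D.e,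
    ← zpow_mul, zpow_add₀ hp0, zpow_natCast, mul_comm ((PadicBase.toPadic hp x).valuation) (D.e : ℤ), mul_comm]

/-- ★ **Distinct indices give distinct norms**: for `x, y ∈ K₀ ∖ 0` and `i ≠ j`, `i, j < e`: `‖ι x·ϖⁱ‖ ≠ ‖ι y·ϖʲ‖` (their `e`-th powers are
`‖p‖^{e·v + i} ≠ ‖p‖^{e·w + j}` since `i ≢ j (mod e)`). [cite: SerreLocalFields1979, Ch. I §6 Prop. 17] -/
theorem norm_term_ne_of_ne {x y : PadicBase F p hp} (hx : x ≠ 0) (hy : y ≠ 0) {i j : ℕ} (hi : i < D.e) (hj : j < D.e) (hij : i ≠ j) :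
    ‖algebraMap F (CompletedAlgClosure F) (algebraMap (PadicBase F p hp) F x) * ((D.rootC : integerC F) : CompletedAlgClosure F) ^ i‖ ≠
      ‖algebraMap F (CompletedAlgClosure F) (algebraMap (PadicBase F p hp) F y) * ((D.rootC : integerC F) : CompletedAlgClosure F) ^ j‖ := by
  intro h
  have he : (‖algebraMap F (CompletedAlgClosure F) (algebraMap (PadicBase F p hp) F x) * ((D.rootC : integerC F) : CompletedAlgClosure F) ^ i‖) ^ D.e =
      (‖algebraMap F (CompletedAlgClosure F) (algebraMap (PadicBase F p hp) F y) * ((D.rootC : integerC F) : CompletedAlgClosure F) ^ j‖) ^ D.e := by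
    rw [h]
  rw [norm_iota_mul_root_pow_pow_e D x hx i, norm_iota_mul_root_pow_pow_e D y hy j] at he
  have hp0 : 0 < ‖(p : CompletedAlgClosure F)‖ := by
    rw [norm_natCast_C_eq_norm_natCast_padicBase hp]; exact PadicBase.norm_p_pos hp
  have hp1 : ‖(p : CompletedAlgClosure F)‖ ≠ 1 := by
    rw [norm_natCast_C_eq_norm_natCast_padicBase hp]; exact (PadicBase.norm_p_lt_one hp).ne
  have hexp : (D.e : ℤ) * (PadicBase.toPadic hp x).valuation + i = (D.e : ℤ) * (PadicBase.toPadic hp y).valuation + j :=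
    zpow_right_injective₀ hp0 hp1 he
  -- `i ≡ j (mod e)` with `i, j < e`
  have hdvd : (D.e : ℤ) ∣ (i : ℤ) - j := ⟨(PadicBase.toPadic hp y).valuation - (PadicBase.toPadic hp x).valuation, by linarith⟩
  have habs : |(i : ℤ) - j| < D.e := by rw [abs_sub_lt_iff]; constructor <;> omega
  have h0 : (i : ℤ) - j = 0 := Int.eq_zero_of_abs_lt_dvd hdvd habs
  exact hij (by omega)

/-! ## §2 Each term is bounded by the sum -/

/-- ★★ **`‖ι(qᵢ)·ϖⁱ‖ ≤ ‖Σ_{j<e} ι(qⱼ)·ϖʲ‖`** for every `i < e`: on the support the norms are pairwise distinct, so the norm of the sum is their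
maximum (ultrametric). [cite: SerreLocalFields1979, Ch. I §6 Prop. 17–18] -/
theorem norm_iota_mul_root_pow_le_norm_sum (q : Fin D.e → PadicBase F p hp) (i : Fin D.e) :
    ‖algebraMap F (CompletedAlgClosure F) (algebraMap (PadicBase F p hp) F (q i)) * ((D.rootC : integerC F) : CompletedAlgClosure F) ^ (i : ℕ)‖ ≤
      ‖∑ j : Fin D.e, algebraMap F (CompletedAlgClosure F) (algebraMap (PadicBase F p hp) F (q j)) *
        ((D.rootC : integerC F) : CompletedAlgClosure F) ^ (j : ℕ)‖ := by
  set f : Fin D.e → CompletedAlgClosure F := fun j =>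
    algebraMap F (CompletedAlgClosure F) (algebraMap (PadicBase F p hp) F (q j)) * ((D.rootC : integerC F) : CompletedAlgClosure F) ^ (j : ℕ)
    with hf
  set s : Finset (Fin D.e) := Finset.univ.filter fun j => q j ≠ 0 with hs
  have hsum : ∑ j : Fin D.e, f j = ∑ j ∈ s, f j := by
    rw [hs, Finset.sum_filter]
    refine Finset.sum_congr rfl fun j _ => ?_
    by_cases h : q j = 0
    · rw [if_neg (not_not.2 h), hf]; simp [h]
    · rw [if_pos h]
  have hpw : Set.Pairwise (s : Set (Fin D.e)) fun a b => ‖f a‖₊ ≠ ‖f b‖₊ := by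
    intro a ha b hb hab
    rw [hs, Finset.coe_filter] at ha hb
    have h := norm_term_ne_of_ne D ha.2 hb.2 a.2 b.2 (fun h => hab (Fin.ext h))
    rw [ne_eq, ← NNReal.coe_inj, coe_nnnorm, coe_nnnorm]
    exact h
  have hsup : ‖∑ j ∈ s, f j‖₊ = s.sup fun j => ‖f j‖₊ := IsUltrametricDist.nnnorm_sum_eq_sup_of_pairwise_ne hpw
  change ‖f i‖ ≤ ‖∑ j : Fin D.e, f j‖
  by_cases hi : q i = 0
  · have : f i = 0 := by rw [hf]; simp [hi]
    rw [this, norm_zero]; exact norm_nonneg _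
  · have hi' : i ∈ s := by rw [hs, Finset.mem_filter]; exact ⟨Finset.mem_univ _, hi⟩
    rw [hsum, ← coe_nnnorm, ← coe_nnnorm, NNReal.coe_le_coe, hsup]
    exact Finset.le_sup (f := fun j => ‖f j‖₊) hi'

/-- ★ **The coordinates are controlled by the element**: `‖qᵢ‖_{K₀} ≤ ‖Σ_{j<e} ι(qⱼ)·ϖʲ‖_{ℂ_F} / ‖p‖` for every `i < e`
(`‖ι qᵢ‖·‖ϖ‖ⁱ ≤ ‖Σ‖` and `‖ϖ‖ⁱ ≥ ‖ϖ‖ᵉ = ‖p‖`). [cite: SerreLocalFields1979, Ch. I §6 Prop. 18] -/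
theorem norm_le_norm_sum_div_norm_p (q : Fin D.e → PadicBase F p hp) (i : Fin D.e) :
    ‖q i‖ ≤ ‖∑ j : Fin D.e, algebraMap F (CompletedAlgClosure F) (algebraMap (PadicBase F p hp) F (q j)) *
        ((D.rootC : integerC F) : CompletedAlgClosure F) ^ (j : ℕ)‖ / ‖(p : CompletedAlgClosure F)‖ := by
  have hp0 : 0 < ‖(p : CompletedAlgClosure F)‖ := by
    rw [norm_natCast_C_eq_norm_natCast_padicBase hp]; exact PadicBase.norm_p_pos hp
  have hϖ : ‖(p : CompletedAlgClosure F)‖ ≤ ‖((D.rootC : integerC F) : CompletedAlgClosure F)‖ ^ (i : ℕ) := by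
    rw [← EisensteinRoot.norm_rootC_pow]
    exact pow_le_pow_of_le_one (norm_nonneg _) D.norm_rootC_lt_one.le i.2.le
  have h1 := norm_iota_mul_root_pow_le_norm_sum D q i
  rw [norm_mul, norm_pow, norm_iota] at h1
  rw [le_div_iff₀ hp0]
  calc ‖q i‖ * ‖(p : CompletedAlgClosure F)‖ ≤ ‖q i‖ * ‖((D.rootC : integerC F) : CompletedAlgClosure F)‖ ^ (i : ℕ) :=
        mul_le_mul_of_nonneg_left hϖ (norm_nonneg _)
    _ ≤ _ := h1

/-! ## §3 Coefficientwise, and the transfer to `ℚ_p`-integrality -/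

/-- **Coordinate series are controlled by the series**: if `G = Σ_{i<e} ϖⁱ·ι_*(Gᵢ)` (`Gᵢ ∈ K₀⟦X_σ⟧`) has `‖[X^d]G‖ ≤ B` for all `d`, then
`‖[X^d]Gᵢ‖ ≤ B/‖p‖` for all `d, i`. [cite: SerreLocalFields1979, Ch. I §6 Prop. 18] -/
theorem norm_coeff_coord_le_of_norm_coeff_sum_le {σ : Type*} (G : Fin D.e → MvPowerSeries σ (PadicBase F p hp)) {B : ℝ}
    (hB : ∀ d, ‖MvPowerSeries.coeff d (∑ j : Fin D.e, MvPowerSeries.C (((D.rootC : integerC F) : CompletedAlgClosure F) ^ (j : ℕ)) *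
      MvPowerSeries.map ((algebraMap F (CompletedAlgClosure F)).comp (algebraMap (PadicBase F p hp) F)) (G j))‖ ≤ B)
    (d : σ →₀ ℕ) (i : Fin D.e) :
    ‖MvPowerSeries.coeff d (G i)‖ ≤ B / ‖(p : CompletedAlgClosure F)‖ := by
  have hp0 : 0 < ‖(p : CompletedAlgClosure F)‖ := by
    rw [norm_natCast_C_eq_norm_natCast_padicBase hp]; exact PadicBase.norm_p_pos hp
  refine (norm_le_norm_sum_div_norm_p D (fun j => MvPowerSeries.coeff d (G j)) i).trans (div_le_div_of_nonneg_right ?_ hp0.le)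
  have h := hB d
  have hsum : MvPowerSeries.coeff d (∑ j : Fin D.e, MvPowerSeries.C (((D.rootC : integerC F) : CompletedAlgClosure F) ^ (j : ℕ)) *
      MvPowerSeries.map ((algebraMap F (CompletedAlgClosure F)).comp (algebraMap (PadicBase F p hp) F)) (G j)) =
      ∑ j : Fin D.e, algebraMap F (CompletedAlgClosure F) (algebraMap (PadicBase F p hp) F (MvPowerSeries.coeff d (G j))) *
        ((D.rootC : integerC F) : CompletedAlgClosure F) ^ (j : ℕ) := by
    rw [map_sum]
    refine Finset.sum_congr rfl fun j _ => ?_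
    rw [MvPowerSeries.coeff_C_mul, MvPowerSeries.coeff_map, RingHom.comp_apply, mul_comm]
  rw [hsum] at h
  exact h

/-- **Transfer of bounds to `ℚ_p`-integrality**: `‖x‖_{K₀} ≤ ‖p‖^{−d}` implies `|p^d·x|_p ≤ 1` (the form of the hypotheses of the tree's
`KatzRankAllFibres.padicRankTwo`). [cite: NeukirchANT1999, Ch. II (4.8)] -/
theorem norm_pow_mul_toPadic_le_one_of_norm_le (hp : valuation F p < 1) (x : PadicBase F p hp) (d : ℕ)
    (hx : ‖x‖ ≤ ‖(p : PadicBase F p hp)‖ ^ (-(d : ℤ))) : ‖(p : ℚ_[p]) ^ d * PadicBase.toPadic hp x‖ ≤ 1 := by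
  have hp0 : 0 < ‖(p : PadicBase F p hp)‖ := PadicBase.norm_p_pos hp
  have h1 : ‖(p : PadicBase F p hp) ^ d * x‖ ≤ 1 := by
    rw [norm_mul, norm_pow]
    calc ‖(p : PadicBase F p hp)‖ ^ d * ‖x‖ ≤ ‖(p : PadicBase F p hp)‖ ^ d * ‖(p : PadicBase F p hp)‖ ^ (-(d : ℤ)) :=
          mul_le_mul_of_nonneg_left hx (pow_nonneg (norm_nonneg _) _)
      _ = 1 := by rw [zpow_neg, zpow_natCast, mul_inv_cancel₀ (pow_ne_zero _ hp0.ne')]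
  have h2 := (PadicBase.norm_le_one_iff hp _).mp h1
  rwa [map_mul, map_pow, map_natCast] at h2

/-- Every real bound is below some `‖p‖^{−d}` (`‖p‖ < 1`: the value group `‖p‖^ℤ` is unbounded). [cite: SerreLocalFields1979, Ch. II §5] -/
theorem exists_le_norm_p_zpow_neg (hp : valuation F p < 1) (B : ℝ) :
    ∃ d : ℕ, B ≤ ‖(p : PadicBase F p hp)‖ ^ (-(d : ℤ)) := by
  have hp0 : 0 < ‖(p : PadicBase F p hp)‖ := PadicBase.norm_p_pos hp
  have hp1 : ‖(p : PadicBase F p hp)‖ < 1 := PadicBase.norm_p_lt_one hp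
  obtain ⟨d, hd⟩ := exists_pow_lt_of_lt_one (inv_pos.2 (lt_of_lt_of_le zero_lt_one (le_max_right B 1))) hp1
  refine ⟨d, ?_⟩
  rw [zpow_neg, zpow_natCast]
  have : ‖(p : PadicBase F p hp)‖ ^ d < (max B 1)⁻¹ := hd
  calc B ≤ max B 1 := le_max_left _ _
    _ ≤ (‖(p : PadicBase F p hp)‖ ^ d)⁻¹ := by
        rw [le_inv_comm₀ (lt_of_lt_of_le zero_lt_one (le_max_right B 1)) (pow_pos hp0 _)]
        exact this.le

/-! ## §4 The bound `‖ϖ‖ʲ ≤ M·‖j‖` (hypothesis `hM` of the transported Hodge line) holds for every Eisenstein datum -/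

/-- Elementary: `log₂ j ≤ j/e + e` for `e ≥ 1` (`4e(L − e) ≤ L² ≤ 4·2ᴸ ≤ 4j`). [folklore] -/
private theorem nat_log_two_le_div_add (e j : ℕ) (he : 0 < e) (hj : j ≠ 0) : Nat.log 2 j ≤ j / e + e := by
  set L := Nat.log 2 j with hL
  have h2L : 2 ^ L ≤ j := Nat.pow_log_le_self 2 hj
  have hsq : ∀ n : ℕ, n * n ≤ 4 * 2 ^ n := by
    intro n
    induction n with
    | zero => simp
    | succ n ih =>
      have h1 : n < 2 ^ n := Nat.lt_two_pow_self
      have h2 : (n + 1) * (n + 1) = n * n + (2 * n + 1) := by ring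
      rw [h2, pow_succ]
      omega
  have h4 : 4 * (e * L) ≤ L * L + 4 * (e * e) := by
    have : (4 * (e * L) : ℤ) ≤ L * L + 4 * (e * e) := by nlinarith [sq_nonneg ((L : ℤ) - 2 * e)]
    exact_mod_cast this
  have h5 : e * L ≤ j + e * e := by
    have := hsq L
    omega
  rw [← Nat.add_mul_div_right j e he, Nat.le_div_iff_mul_le he, Nat.mul_comm]
  exact h5

/-- ★ **`‖ϖ‖ʲ ≤ M·‖j‖_{ℂ_F}` for all `j ≥ 1`**, with `M = ‖p‖^{−(e+1)}`: the hypothesis `hM` of the transported Hodge line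
(`TransportedHodgeLine.exists_transportedHodgeLine`, `EisensteinFormalLogCoordinates.exists_coords_formalLog_secondKind`) holds for EVERY Eisenstein
datum (`‖ϖ‖ᵉ = ‖p‖`, `‖j‖ ≥ ‖p‖^{v_p(j)+1}`, `v_p(j) ≤ log₂ j ≤ j/e + e`). [cite: SerreLocalFields1979, Ch. I §6 Prop. 17] -/
theorem exists_norm_rootC_pow_le_mul_norm_natCast :
    ∃ M : ℝ, 0 ≤ M ∧ ∀ j : ℕ, 1 ≤ j →
      ‖((D.rootC : integerC F) : CompletedAlgClosure F)‖ ^ j ≤ M * ‖(j : CompletedAlgClosure F)‖ := by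
  set r : ℝ := ‖(p : PadicBase F p hp)‖ with hr
  have hr0 : 0 < r := PadicBase.norm_p_pos hp
  have hr1 : r < 1 := PadicBase.norm_p_lt_one hp
  have hϖe : ‖((D.rootC : integerC F) : CompletedAlgClosure F)‖ ^ D.e = r := by
    rw [EisensteinRoot.norm_rootC_pow, norm_natCast_C_eq_norm_natCast_padicBase hp]
  refine ⟨r⁻¹ ^ (D.e + 1), by positivity, fun j hj => ?_⟩
  have hj0 : j ≠ 0 := by omega
  -- `‖j‖_{ℂ_F} = ‖j‖_{K₀} ≥ r^{v_p(j)+1}`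
  have hjC : ‖(j : CompletedAlgClosure F)‖ = ‖(j : PadicBase F p hp)‖ := by
    have h1 : (j : CompletedAlgClosure F) = algebraMap F (CompletedAlgClosure F) (algebraMap (PadicBase F p hp) F (j : PadicBase F p hp)) := by
      rw [map_natCast, map_natCast]
    rw [h1, norm_iota]
  have hjlow : r ^ (padicValNat p j + 1) ≤ ‖(j : PadicBase F p hp)‖ := by
    refine le_of_not_gt fun hlt => ?_
    have h1 : (j : PadicBase F p hp) = PadicBase.ofPadicInt hp ((j : ℤ) : ℤ_[p]) := by rw [Int.cast_natCast, map_natCast]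
    have hle := hlt.le
    rw [h1, PadicBase.norm_ofPadicInt_le_pow_iff, PadicInt.norm_int_le_pow_iff_dvd] at hle
    exact pow_succ_padicValNat_not_dvd hj0 (by exact_mod_cast hle)
  -- `v_p(j) + 1 ≤ j/e + e + 1`
  have hv : padicValNat p j + 1 ≤ j / D.e + D.e + 1 := by
    have h1 : padicValNat p j ≤ Nat.log 2 j :=
      (padicValNat_le_nat_log j).trans (Nat.log_anti_left (by norm_num) hpp.out.two_le)
    have h2 := nat_log_two_le_div_add D.e j D.e_pos hj0
    omega
  -- `‖ϖ‖ʲ ≤ r^{⌊j/e⌋}`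
  have hϖ1 : ‖((D.rootC : integerC F) : CompletedAlgClosure F)‖ ≤ 1 := D.norm_rootC_lt_one.le
  have hup : ‖((D.rootC : integerC F) : CompletedAlgClosure F)‖ ^ j ≤ r ^ (j / D.e) := by
    rw [← hϖe, ← pow_mul]
    exact pow_le_pow_of_le_one (norm_nonneg _) hϖ1 (by rw [mul_comm]; exact Nat.div_mul_le_self j D.e)
  calc ‖((D.rootC : integerC F) : CompletedAlgClosure F)‖ ^ j ≤ r ^ (j / D.e) := hup
    _ = r⁻¹ ^ (D.e + 1) * r ^ (j / D.e + D.e + 1) := by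
        have hr0' : r ≠ 0 := hr0.ne'
        rw [inv_pow]
        field_simp
        ring
    _ ≤ r⁻¹ ^ (D.e + 1) * r ^ (padicValNat p j + 1) :=
        mul_le_mul_of_nonneg_left (pow_le_pow_of_le_one hr0.le hr1.le hv) (by positivity)
    _ ≤ r⁻¹ ^ (D.e + 1) * ‖(j : CompletedAlgClosure F)‖ := by
        rw [hjC]; exact mul_le_mul_of_nonneg_left hjlow (by positivity)

end Literature.NumberTheory.PAdicHodge
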